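import Mathlib.Analysis.Calculus.DerivativeTest
import Mathlib.Analysis.Calculus.LocalExtr.Basic
import Literature.Analysis.FluidPDE.PassiveScalarClassicalEnergy
import HarnessLib

/-!
# The maximum principle for classical passive scalars on the torus

Topic `Literature/Analysis/FluidPDE` (passive scalar cluster; theorems only). For a classical
solution `θ` of the advection–diffusion equation `∂ₜθ + u·∇θ = κΔθ` (`κ ≥ 0`, `u` smooth and
divergence free) on `[a, b] × T^d`,

  `θ(t, x) ≤ sup θ(a, ·)`,   `|θ(t, x)| ≤ sup |θ(a, ·)|`   (`t ∈ [a, b]`),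

(`Torus.IsClassicalScalarTransportOn.le_of_forall_init_le`, `…abs_le_of_forall_abs_init_le`).
This is the "maximum principle on `θ_{κ,2}`" invoked in the proof of Johansson–Sorella 2024,
Lemma 2.2 (arXiv:2409.03599, p. 8), which supplies the constant `‖θ_in‖_{L^∞}` of that lemma
(tree: `Torus.IsClassicalScalarTransportOn.integral_sub_sq_add_dissipation_le_of_drifts`,
`PassiveScalarDriftStability`, takes the sup bound as a hypothesis), and in Prop. 4.3 (p. 12:
"satisfies the maximum principle"). The proof is the textbook one (Evans 2010, §7.1.4, Thm. 8,
weak maximum principle for parabolic operators, `c = 0`; Lieberman 1996, Ch. II, Lemma 2.1):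
for `ε > 0` the function `v = θ - ε(t - a)` attains its maximum over the compact
`[a, b] × T^d` at some `(t₀, x₀)`; if `t₀ > a` then `∇θ(t₀, x₀) = 0`, `Δθ(t₀, x₀) ≤ 0` and
`∂ₜθ(t₀, x₀) ≥ ε` (one-sided in time, Fermat on the positive tangent cone of `[a, b]`), which
contradicts the equation `∂ₜθ = κΔθ - u·∇θ ≤ 0` there; hence `t₀ = a` and
`θ ≤ sup θ(a) + ε(b - a)`, and `ε → 0`. The lower bound follows by applying this to `-θ`
(`Torus.IsClassicalScalarTransportOn.neg`). The second-order condition at a spatial maximum is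
read in the chart `liftAt` (`Torus.laplacian f x = Δ(liftAt f x)(0)`), through a local copy of
the tree's `IsLocalMax.laplacian_nonpos` (`ParabolicComparison`, not imported here to keep the
passive-scalar cluster light).

**With a source term** (appended; cell `ad-ideate`, seat ad-p2, K3′ line v2): for a jointly smooth `g` with
`∂ₜg + u·∇g = κΔg + f` pointwise and `f(t, ·) ≤ F(t)` on `[a, b]`,
`g(t, x) ≤ sup g(a, ·) + ∫ₐᵗ F` (`Torus.le_add_of_forall_init_le_of_source` with an antiderivative `Φ` of `F`,
`Torus.le_add_integral_of_source` for `F` continuous on `[a, b]`; two-sided forms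
`Torus.abs_le_add_of_forall_abs_init_le_of_source`, `Torus.abs_le_add_integral_of_source`) — the same
`ε`-perturbation proof with `v = g − (Φ − Φ(a)) − ε(t − a)` (Evans 2010, §7.1.4, Thms. 8–9).  The drift `u` is
arbitrary here (it is killed by `∇g = 0` at the maximiser); no structure is assumed, only the pointwise equation.

## References

* C. J. P. Johansson, M. Sorella, arXiv:2409.03599v2 (2024), Lemma 2.2 (proof: "using the maximum
  principle on `θ_{κ,2}`"), p. 8; Prop. 4.3, p. 12. [`JohanssonSorella2024`]
* L. C. Evans, *Partial Differential Equations*, 2nd ed. (2010), §7.1.4, Thm. 8 (weak maximum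
  principle). [`Evans2010`]
-/

open MeasureTheory Set Filter
open _root_.Topology
open scoped InnerProductSpace ContDiff Laplacian

noncomputable section

namespace Literature.Analysis.FluidPDE

namespace Torus

open Literature.Analysis.FunctionSpaces.Torus (proj repr liftAt stLift proj_repr proj_zero
  liftAt_apply isCompact_toLp_image_pi_Icc repr_mem_toLp_image_pi_Icc)

/-! ## Second-order condition at an interior maximum (Euclidean chart) -/

section LocalMax

variable {E : Type*} [NormedAddCommGroup E] [InnerProductSpace ℝ E] [FiniteDimensional ℝ E]

omit [FiniteDimensional ℝ E] in
/-- Along a line: `s ↦ W(x + s e)` has derivative `DW(x + s e) e` (private local twin of the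
tree's `hasDerivAt_comp_line`, `ParabolicComparison`, which this light file must not import). [folklore] -/
private theorem hasDerivAt_comp_line' {W : E → ℝ} (hW : Differentiable ℝ W) (x e : E) (s : ℝ) :
    HasDerivAt (fun σ : ℝ => W (x + σ • e)) (fderiv ℝ W (x + s • e) e) s := by
  have hl : HasDerivAt (fun σ : ℝ => x + σ • e) e s := by
    simpa using ((hasDerivAt_id s).smul_const e).const_add x
  exact (hW (x + s • e)).hasFDerivAt.comp_hasDerivAt s hl

/-- One-dimensional second-derivative test, necessary form: at a local maximum where `φ` is
continuous, `φ'' ≤ 0` (private local twin of the tree's `IsLocalMax.deriv_deriv_nonpos`,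
`ParabolicComparison`). [folklore] -/
private theorem deriv_deriv_nonpos_of_isLocalMax' {φ : ℝ → ℝ} {σ₀ : ℝ} (h : IsLocalMax φ σ₀)
    (hc : ContinuousAt φ σ₀) : deriv (deriv φ) σ₀ ≤ 0 := by
  by_contra hpos
  push Not at hpos
  have hd : deriv φ σ₀ = 0 := h.deriv_eq_zero
  have hmin : IsLocalMin φ σ₀ := isLocalMin_of_deriv_deriv_pos hpos hd hc
  have heq : φ =ᶠ[𝓝 σ₀] fun _ => φ σ₀ :=
    (h.and hmin).mono fun s hs => le_antisymm hs.1 hs.2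
  have h1 : deriv φ =ᶠ[𝓝 σ₀] deriv fun _ : ℝ => φ σ₀ := heq.deriv
  have h2 : deriv (deriv φ) σ₀ = deriv (deriv fun _ : ℝ => φ σ₀) σ₀ := h1.deriv_eq
  rw [h2] at hpos
  simp at hpos

/-- At an interior local maximum of a `C²` function the Laplacian is nonpositive (private local
twin of the tree's `IsLocalMax.laplacian_nonpos`, `ParabolicComparison` — that file imports the
whole-space Littlewood–Paley/Sobolev stack, which the passive-scalar cluster must not pull in;
second-derivative test along the lines of an orthonormal frame, `ΔW = Σᵢ D²W[eᵢ, eᵢ]`). [cite: Evans2010, §7.1.4 Thm. 8 (proof)] -/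
private theorem laplacian_nonpos_of_isLocalMax' {W : E → ℝ} {x : E} (hW : ContDiff ℝ 2 W)
    (h : IsLocalMax W x) : (Δ W) x ≤ 0 := by
  rw [InnerProductSpace.laplacian_eq_iteratedFDeriv_orthonormalBasis W (stdOrthonormalBasis ℝ E)]
  refine Finset.sum_nonpos fun i _ => ?_
  set e : E := stdOrthonormalBasis ℝ E i
  set φ : ℝ → ℝ := fun σ => W (x + σ • e) with hφ
  have hWd : Differentiable ℝ W := hW.differentiable two_ne_zero
  have hφ1 : deriv φ = fun σ => fderiv ℝ W (x + σ • e) e :=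
    funext fun σ => (hasDerivAt_comp_line' hWd x e σ).deriv
  have hD1 : ContDiff ℝ 1 fun z => fderiv ℝ W z e :=
    (hW.fderiv_right (m := 1) le_rfl).clm_apply contDiff_const
  have hff : fderiv ℝ (fun y => fderiv ℝ W y e) x e = iteratedFDeriv ℝ 2 W x ![e, e] := by
    have hd : DifferentiableAt ℝ (fderiv ℝ W) x :=
      ((hW.fderiv_right (m := 1) le_rfl).differentiable one_ne_zero) x
    rw [iteratedFDeriv_two_apply, fderiv_clm_apply hd (differentiableAt_const e)]
    simp
  have hφ2 : deriv (deriv φ) 0 = iteratedFDeriv ℝ 2 W x ![e, e] := by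
    rw [hφ1, ← hff]
    have h2 := hasDerivAt_comp_line' (hD1.differentiable one_ne_zero) x e 0
    rw [zero_smul, add_zero] at h2
    exact h2.deriv
  have hmax : IsLocalMax φ 0 := by
    have hx : IsLocalMax W ((fun σ : ℝ => x + σ • e) 0) := by
      rw [show (fun σ : ℝ => x + σ • e) 0 = x by simp]
      exact h
    have hl : ContinuousAt (fun σ : ℝ => x + σ • e) 0 := by fun_prop
    exact IsLocalMax.comp_continuous (g := fun σ : ℝ => x + σ • e) hx hl
  have hcφ : ContinuousAt φ 0 := (hWd.continuous.comp (by fun_prop)).continuousAt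
  rw [← hφ2]
  exact deriv_deriv_nonpos_of_isLocalMax' hmax hcφ

end LocalMax

variable {d : Type*} [Fintype d] [DecidableEq d]

namespace IsClassicalScalarTransportOn

variable {S : Set ℝ} {κ : ℝ} {u : ℝ → UnitAddTorus d → EuclideanSpace ℝ d}
  {θ : ℝ → UnitAddTorus d → ℝ}

/-- Classical advection–diffusion is linear: `-θ` is a classical solution with the same drift
(on a time set of unique differentiability, so that one-sided time derivatives commute with
negation). [folklore] -/
theorem neg (h : IsClassicalScalarTransportOn S κ u θ) (hU : UniqueDiffOn ℝ S) :
    IsClassicalScalarTransportOn S κ u (fun t x => -θ t x) where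
  smooth_velocity := h.smooth_velocity
  smooth_scalar := h.smooth_scalar.neg
  transport t ht x := by
    have hθt : FunctionSpaces.Torus.IsSmooth (θ t) := h.smooth_scalar.isSmooth_slice ht
    have hd : FunctionSpaces.Torus.timeDerivWithin S (fun t x => -θ t x) t x =
        -FunctionSpaces.Torus.timeDerivWithin S θ t x :=
      ((h.smooth_scalar.hasDerivWithinAt_slice ht x).neg).derivWithin (hU t ht)
    have hg : FunctionSpaces.Torus.gradient (fun x => -θ t x) x =
        -FunctionSpaces.Torus.gradient (θ t) x := by
      change _root_.gradient (liftAt (fun x => -θ t x) x) 0 = -_root_.gradient (liftAt (θ t) x) 0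
      rw [show liftAt (fun x => -θ t x) x = fun v => -liftAt (θ t) x v from rfl, _root_.gradient,
        _root_.gradient, fderiv_fun_neg, map_neg]
    have hl : FunctionSpaces.Torus.laplacian (fun x => -θ t x) x =
        -FunctionSpaces.Torus.laplacian (θ t) x := by
      change (Δ (liftAt (fun x => -θ t x) x)) 0 = -(Δ (liftAt (θ t) x)) 0
      rw [show liftAt (fun x => -θ t x) x = -liftAt (θ t) x from rfl,
        InnerProductSpace.laplacian_neg, Pi.neg_apply]
    have he := h.transport t ht x
    rw [hd, hg, hl, inner_neg_right]
    linarith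
  divFree := h.divFree

/-- **Weak maximum principle for classical passive scalars on `T^d` (upper bound).** If `θ`
solves `∂ₜθ + u·∇θ = κΔθ` classically on `S ⊇ [a, b]` with `κ ≥ 0` and `θ(a, ·) ≤ M`, then
`θ(t, ·) ≤ M` for all `t ∈ [a, b]` (Evans 2010, §7.1.4 Thm. 8 with `c = 0`, `f = 0`; the
maximum principle used in Johansson–Sorella 2024, Lemma 2.2 and Prop. 4.3). Proof in the module
docstring (`ε`-perturbation, compactness of `[a, b] × T^d`, first- and second-order conditions
at the maximiser in the chart `liftAt`, Fermat on the positive tangent cone of `[a, b]`). [cite: Evans2010, §7.1.4 Thm. 8] -/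
theorem le_of_forall_init_le (h : IsClassicalScalarTransportOn S κ u θ) (hκ : 0 ≤ κ) {a b : ℝ}
    (hI : Icc a b ⊆ S) {M : ℝ} (hM : ∀ x, θ a x ≤ M) {t : ℝ} (ht : t ∈ Icc a b)
    (x : UnitAddTorus d) : θ t x ≤ M := by
  rcases eq_or_lt_of_le ht.1 with rfl | hat
  · exact hM x
  have hab : a < b := hat.trans_le ht.2
  have h' := h.restrict_Icc hab hI
  refine le_of_forall_pos_le_add fun δ hδ => ?_
  -- the perturbation `v = θ - ε (t - a)`, `ε (b - a) = δ`
  set ε : ℝ := δ / (b - a) with hε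
  have hba : 0 < b - a := sub_pos.2 hab
  have hεpos : 0 < ε := div_pos hδ hba
  have hεδ : ε * (b - a) = δ := div_mul_cancel₀ δ hba.ne'
  set v : ℝ → UnitAddTorus d → ℝ := fun s y => θ s y - ε * (s - a) with hv
  have hvc : ContinuousOn (stLift v) (Icc a b ×ˢ univ) := by
    have hθc := h'.smooth_scalar.continuousOn_stLift
    have e : stLift v = fun p => stLift θ p - ε * (p.1 - a) := by
      funext p
      rfl
    rw [e]
    exact hθc.sub ((continuous_const.mul (continuous_fst.sub continuous_const)).continuousOn)
  -- a maximiser of `v` on the compact `[a, b] × [0, 1]^d ⊂ ℝ × ℝ^d`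
  set K : Set (ℝ × EuclideanSpace ℝ d) :=
    Icc a b ×ˢ ((WithLp.toLp 2) '' (Set.pi univ fun _ : d => Icc (0 : ℝ) 1)) with hK
  have hKc : IsCompact K := isCompact_Icc.prod isCompact_toLp_image_pi_Icc
  have hKne : K.Nonempty :=
    ⟨(a, repr x), mk_mem_prod (left_mem_Icc.2 hab.le) (repr_mem_toLp_image_pi_Icc x)⟩
  obtain ⟨p, hpK, hpmax⟩ :=
    hKc.exists_isMaxOn hKne (hvc.mono (prod_mono subset_rfl (subset_univ _)))
  obtain ⟨t₀, y₀⟩ := p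
  have ht₀ : t₀ ∈ Icc a b := (mem_prod.1 hpK).1
  set x₀ : UnitAddTorus d := proj y₀ with hx₀
  have hmax : ∀ s ∈ Icc a b, ∀ y, v s y ≤ v t₀ x₀ := fun s hs y => by
    have h1 := hpmax (mk_mem_prod hs (repr_mem_toLp_image_pi_Icc y))
    simpa [stLift, proj_repr] using h1
  by_cases h0 : t₀ = a
  · -- the maximum sits on the initial slice
    have h1 := hmax t ht x
    have hva : v t₀ x₀ = θ a x₀ := by
      simp only [hv, h0, sub_self, mul_zero, sub_zero]
    have hvt : v t x = θ t x - ε * (t - a) := rfl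
    have hmono : ε * (t - a) ≤ ε * (b - a) :=
      mul_le_mul_of_nonneg_left (by linarith [ht.2]) hεpos.le
    linarith [hM x₀]
  · -- an interior (in time) maximum contradicts the equation
    exfalso
    have hat₀ : a < t₀ := lt_of_le_of_ne ht₀.1 (Ne.symm h0)
    have hθt₀ : FunctionSpaces.Torus.IsSmooth (θ t₀) := h'.smooth_scalar.isSmooth_slice ht₀
    -- spatial first- and second-order conditions at `x₀`, in the chart `liftAt`
    have hsp : IsLocalMax (liftAt (θ t₀) x₀) 0 := Filter.Eventually.of_forall fun w => by
      have h1 := hmax t₀ ht₀ (x₀ + proj w)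
      simp only [hv] at h1
      simp only [liftAt_apply, proj_zero, add_zero]
      linarith
    have hC2 : ContDiff ℝ 2 (liftAt (θ t₀) x₀) := (hθt₀.isContDiff (n := 2) (WithTop.coe_le_coe.mpr le_top)).liftAt x₀
    have hlap : FunctionSpaces.Torus.laplacian (θ t₀) x₀ ≤ 0 := laplacian_nonpos_of_isLocalMax' hC2 hsp
    have hgrad : FunctionSpaces.Torus.gradient (θ t₀) x₀ = 0 := by
      change _root_.gradient (liftAt (θ t₀) x₀) 0 = 0
      rw [_root_.gradient, hsp.fderiv_eq_zero, map_zero]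
    -- temporal first-order condition at `t₀ > a` (one-sided, positive tangent cone of `[a, b]`)
    have hslice : HasDerivWithinAt (fun s => v s x₀)
        (FunctionSpaces.Torus.timeDerivWithin (Icc a b) θ t₀ x₀ - ε) (Icc a b) t₀ := by
      have h1 := h'.smooth_scalar.hasDerivWithinAt_slice ht₀ x₀
      have h2 : HasDerivWithinAt (fun s : ℝ => ε * (s - a)) (ε * 1) (Icc a b) t₀ :=
        ((hasDerivWithinAt_id t₀ (Icc a b)).sub_const a).const_mul ε
      rw [mul_one] at h2
      exact h1.sub h2
    have hlocmax : IsLocalMaxOn (fun s => v s x₀) (Icc a b) t₀ :=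
      (show IsMaxOn (fun s => v s x₀) (Icc a b) t₀ from fun s hs => hmax s hs x₀).localize
    have hcone : a - t₀ ∈ posTangentConeAt (Icc a b) t₀ :=
      sub_mem_posTangentConeAt_of_segment_subset
        ((convex_Icc a b).segment_subset ht₀ (left_mem_Icc.2 hab.le))
    have hsign := hlocmax.hasFDerivWithinAt_nonpos hslice.hasFDerivWithinAt hcone
    have hsign' : (a - t₀) * (FunctionSpaces.Torus.timeDerivWithin (Icc a b) θ t₀ x₀ - ε) ≤ 0 := by
      simpa using hsign
    have htD : ε ≤ FunctionSpaces.Torus.timeDerivWithin (Icc a b) θ t₀ x₀ := by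
      nlinarith
    -- the equation at `(t₀, x₀)`: `∂ₜθ = κΔθ - u·∇θ = κΔθ ≤ 0`
    have heq := h'.transport t₀ ht₀ x₀
    rw [hgrad, inner_zero_right, add_zero] at heq
    have hkl : κ * FunctionSpaces.Torus.laplacian (θ t₀) x₀ ≤ 0 := mul_nonpos_of_nonneg_of_nonpos hκ hlap
    linarith

/-- **Weak maximum principle for classical passive scalars on `T^d` (two-sided).** If `θ` solves
`∂ₜθ + u·∇θ = κΔθ` classically on `S ⊇ [a, b]` with `κ ≥ 0` and `|θ(a, ·)| ≤ M`, then
`|θ(t, ·)| ≤ M` for all `t ∈ [a, b]`: "the maximum principle on `θ_{κ,2}`",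
`‖θ_κ(t)‖_{L^∞} ≤ ‖θ_in‖_{L^∞}`, of Johansson–Sorella 2024, Lemma 2.2 and Prop. 4.3 (apply
`le_of_forall_init_le` to `θ` and to `-θ`, `IsClassicalScalarTransportOn.neg`). [cite: JohanssonSorella2024, Lemma 2.2 (proof), p. 8] -/
theorem abs_le_of_forall_abs_init_le (h : IsClassicalScalarTransportOn S κ u θ) (hκ : 0 ≤ κ)
    {a b : ℝ} (hI : Icc a b ⊆ S) {M : ℝ} (hM : ∀ x, |θ a x| ≤ M) {t : ℝ} (ht : t ∈ Icc a b)
    (x : UnitAddTorus d) : |θ t x| ≤ M := by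
  rcases eq_or_lt_of_le ht.1 with rfl | hat
  · exact hM x
  have hab : a < b := hat.trans_le ht.2
  have h' := h.restrict_Icc hab hI
  rw [abs_le]
  refine ⟨?_, h'.le_of_forall_init_le hκ subset_rfl (fun y => (le_abs_self _).trans (hM y)) ht x⟩
  have hn := (h'.neg (uniqueDiffOn_Icc hab)).le_of_forall_init_le hκ subset_rfl
    (fun y => (neg_le_abs _).trans (hM y)) ht x
  linarith


end IsClassicalScalarTransportOn

/-! ## The maximum principle WITH A SOURCE TERM

For a jointly smooth `g` solving `∂ₜg + u·∇g = κΔg + f` pointwise on `S × T^d` (`κ ≥ 0`; `u` arbitrary — it is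
killed at the maximiser by `∇g = 0`), a pointwise bound `f(t, ·) ≤ F(t)` on `[a, b] ⊆ S` and an antiderivative `Φ` of
`F` on `[a, b]`: `g(t, x) ≤ sup g(a, ·) + (Φ(t) − Φ(a))`, i.e. `sup g(t) ≤ sup g(a) + ∫ₐᵗ sup f` (Evans 2010, §7.1.4,
proof of Thm. 8/9 with `c = 0`: the same `ε`-perturbation argument, now with `v = g − (Φ − Φ(a)) − ε(t − a)`;
Lieberman 1996, Ch. II, Lemma 2.1).  Two-sided form for `|f| ≤ F`; integral forms for `F` continuous on `[a, b]`.
Motivation (cell `ad-ideate`, seat ad-p2, K3′ line v2 `ShearGradientEnvelope`): across one shear pulse the derivative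
`∂_∥θ` of a passive scalar solves the source-free equation and `∂_⊥θ` the equation with source `−(rate)·U′·∂_∥θ`, so
the sup-gradient envelope per pulse is this lemma with `F = |rate|·sup|∂_∥θ(start)|`. -/

section Source

variable {S : Set ℝ} {κ : ℝ} {u : ℝ → UnitAddTorus d → EuclideanSpace ℝ d} {g f : ℝ → UnitAddTorus d → ℝ}

omit [DecidableEq d] in
/-- Core of the maximum principle with source, on the time interval itself (`S = [a, b]`, `a < b`).
[cite: Evans2010, §7.1.4 Thm. 8 (proof, with a source term: Thm. 9)] -/
private theorem le_add_of_source_Icc {a b : ℝ} (hab : a < b)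
    (hg : FunctionSpaces.Torus.IsSmoothSpaceTimeOn (Icc a b) g)
    (heq : ∀ t ∈ Icc a b, ∀ x, FunctionSpaces.Torus.timeDerivWithin (Icc a b) g t x +
        ⟪u t x, FunctionSpaces.Torus.gradient (g t) x⟫_ℝ =
        κ * FunctionSpaces.Torus.laplacian (g t) x + f t x)
    (hκ : 0 ≤ κ) {M : ℝ} (hM : ∀ x, g a x ≤ M) {F Φ : ℝ → ℝ} (hfF : ∀ t ∈ Icc a b, ∀ x, f t x ≤ F t)
    (hΦ : ∀ t ∈ Icc a b, HasDerivWithinAt Φ (F t) (Icc a b) t) {t : ℝ} (ht : t ∈ Icc a b)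
    (x : UnitAddTorus d) : g t x ≤ M + (Φ t - Φ a) := by
  refine le_of_forall_pos_le_add fun δ hδ => ?_
  set ε : ℝ := δ / (b - a) with hε
  have hba : 0 < b - a := sub_pos.2 hab
  have hεpos : 0 < ε := div_pos hδ hba
  have hεδ : ε * (b - a) = δ := div_mul_cancel₀ δ hba.ne'
  have hΦc : ContinuousOn Φ (Icc a b) := fun s hs => (hΦ s hs).continuousWithinAt
  set v : ℝ → UnitAddTorus d → ℝ := fun s y => g s y - (Φ s - Φ a) - ε * (s - a) with hv
  have hvc : ContinuousOn (stLift v) (Icc a b ×ˢ univ) := by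
    have hgc := hg.continuousOn_stLift
    have e : stLift v = fun p => stLift g p - (Φ p.1 - Φ a) - ε * (p.1 - a) := by
      funext p
      rfl
    rw [e]
    refine (hgc.sub ?_).sub ((continuous_const.mul (continuous_fst.sub continuous_const)).continuousOn)
    exact (hΦc.comp continuous_fst.continuousOn fun p hp => (mem_prod.1 hp).1).sub continuousOn_const
  -- a maximiser of `v` on the compact `[a, b] × [0, 1]^d ⊂ ℝ × ℝ^d`
  set K : Set (ℝ × EuclideanSpace ℝ d) :=
    Icc a b ×ˢ ((WithLp.toLp 2) '' (Set.pi univ fun _ : d => Icc (0 : ℝ) 1)) with hK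
  have hKc : IsCompact K := isCompact_Icc.prod isCompact_toLp_image_pi_Icc
  have hKne : K.Nonempty :=
    ⟨(a, repr x), mk_mem_prod (left_mem_Icc.2 hab.le) (repr_mem_toLp_image_pi_Icc x)⟩
  obtain ⟨p, hpK, hpmax⟩ :=
    hKc.exists_isMaxOn hKne (hvc.mono (prod_mono subset_rfl (subset_univ _)))
  obtain ⟨t₀, y₀⟩ := p
  have ht₀ : t₀ ∈ Icc a b := (mem_prod.1 hpK).1
  set x₀ : UnitAddTorus d := proj y₀ with hx₀
  have hmax : ∀ s ∈ Icc a b, ∀ y, v s y ≤ v t₀ x₀ := fun s hs y => by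
    have h1 := hpmax (mk_mem_prod hs (repr_mem_toLp_image_pi_Icc y))
    simpa [stLift, proj_repr] using h1
  by_cases h0 : t₀ = a
  · -- the maximum sits on the initial slice
    have h1 := hmax t ht x
    have hva : v t₀ x₀ = g a x₀ := by
      simp only [hv, h0, sub_self, mul_zero, sub_zero]
    have hvt : v t x = g t x - (Φ t - Φ a) - ε * (t - a) := rfl
    have hmono : ε * (t - a) ≤ ε * (b - a) :=
      mul_le_mul_of_nonneg_left (by linarith [ht.2]) hεpos.le
    linarith [hM x₀]
  · -- an interior (in time) maximum contradicts the equation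
    exfalso
    have hat₀ : a < t₀ := lt_of_le_of_ne ht₀.1 (Ne.symm h0)
    have hgt₀ : FunctionSpaces.Torus.IsSmooth (g t₀) := hg.isSmooth_slice ht₀
    have hsp : IsLocalMax (liftAt (g t₀) x₀) 0 := Filter.Eventually.of_forall fun w => by
      have h1 := hmax t₀ ht₀ (x₀ + proj w)
      simp only [hv] at h1
      simp only [liftAt_apply, proj_zero, add_zero]
      linarith
    have hC2 : ContDiff ℝ 2 (liftAt (g t₀) x₀) :=
      (hgt₀.isContDiff (n := 2) (WithTop.coe_le_coe.mpr le_top)).liftAt x₀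
    have hlap : FunctionSpaces.Torus.laplacian (g t₀) x₀ ≤ 0 := laplacian_nonpos_of_isLocalMax' hC2 hsp
    have hgrad : FunctionSpaces.Torus.gradient (g t₀) x₀ = 0 := by
      change _root_.gradient (liftAt (g t₀) x₀) 0 = 0
      rw [_root_.gradient, hsp.fderiv_eq_zero, map_zero]
    -- temporal first-order condition at `t₀ > a`
    have hslice : HasDerivWithinAt (fun s => v s x₀)
        (FunctionSpaces.Torus.timeDerivWithin (Icc a b) g t₀ x₀ - F t₀ - ε) (Icc a b) t₀ := by
      have h1 := hg.hasDerivWithinAt_slice ht₀ x₀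
      have h2 : HasDerivWithinAt (fun s : ℝ => ε * (s - a)) (ε * 1) (Icc a b) t₀ :=
        ((hasDerivWithinAt_id t₀ (Icc a b)).sub_const a).const_mul ε
      rw [mul_one] at h2
      have h3 : HasDerivWithinAt (fun s : ℝ => Φ s - Φ a) (F t₀) (Icc a b) t₀ := (hΦ t₀ ht₀).sub_const _
      exact (h1.sub h3).sub h2
    have hlocmax : IsLocalMaxOn (fun s => v s x₀) (Icc a b) t₀ :=
      (show IsMaxOn (fun s => v s x₀) (Icc a b) t₀ from fun s hs => hmax s hs x₀).localize
    have hcone : a - t₀ ∈ posTangentConeAt (Icc a b) t₀ :=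
      sub_mem_posTangentConeAt_of_segment_subset
        ((convex_Icc a b).segment_subset ht₀ (left_mem_Icc.2 hab.le))
    have hsign := hlocmax.hasFDerivWithinAt_nonpos hslice.hasFDerivWithinAt hcone
    have hsign' : (a - t₀) * (FunctionSpaces.Torus.timeDerivWithin (Icc a b) g t₀ x₀ - F t₀ - ε) ≤ 0 := by
      simpa using hsign
    have htD : F t₀ + ε ≤ FunctionSpaces.Torus.timeDerivWithin (Icc a b) g t₀ x₀ := by
      nlinarith
    -- the equation at `(t₀, x₀)`: `∂ₜg = κΔg - u·∇g + f ≤ F t₀`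
    have he := heq t₀ ht₀ x₀
    rw [hgrad, inner_zero_right, add_zero] at he
    have hkl : κ * FunctionSpaces.Torus.laplacian (g t₀) x₀ ≤ 0 := mul_nonpos_of_nonneg_of_nonpos hκ hlap
    have hfb := hfF t₀ ht₀ x₀
    linarith

omit [DecidableEq d] in
/-- **Maximum principle with a source term (upper bound).** If `g` is jointly smooth on `S × T^d` and solves
`∂ₜg + u·∇g = κΔg + f` pointwise on `S ⊇ [a, b]` with `κ ≥ 0`, `g(a, ·) ≤ M`, `f(t, ·) ≤ F(t)` on `[a, b]`, and `Φ`
has one-sided derivative `F` within `[a, b]`, then `g(t, x) ≤ M + (Φ(t) − Φ(a))` on `[a, b]` — i.e.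
`sup g(t) ≤ sup g(a) + ∫ₐᵗ sup f` (Evans' weak maximum principle for `u_t + Lu = f`, `c = 0`, run with the
`ε`-perturbation `v = g − (Φ − Φ(a)) − ε(t − a)`). [cite: Evans2010, §7.1.4 Thm. 8–9 (weak maximum principle, c = 0, with source)] -/
theorem le_add_of_forall_init_le_of_source (hg : FunctionSpaces.Torus.IsSmoothSpaceTimeOn S g)
    (heq : ∀ t ∈ S, ∀ x, FunctionSpaces.Torus.timeDerivWithin S g t x +
        ⟪u t x, FunctionSpaces.Torus.gradient (g t) x⟫_ℝ =
        κ * FunctionSpaces.Torus.laplacian (g t) x + f t x)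
    (hκ : 0 ≤ κ) {a b : ℝ} (hI : Icc a b ⊆ S) {M : ℝ} (hM : ∀ x, g a x ≤ M) {F Φ : ℝ → ℝ}
    (hfF : ∀ t ∈ Icc a b, ∀ x, f t x ≤ F t) (hΦ : ∀ t ∈ Icc a b, HasDerivWithinAt Φ (F t) (Icc a b) t)
    {t : ℝ} (ht : t ∈ Icc a b) (x : UnitAddTorus d) : g t x ≤ M + (Φ t - Φ a) := by
  rcases eq_or_lt_of_le ht.1 with rfl | hat
  · simpa using hM x
  have hab : a < b := hat.trans_le ht.2
  have hg' := hg.mono hI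
  have heq' : ∀ s ∈ Icc a b, ∀ y, FunctionSpaces.Torus.timeDerivWithin (Icc a b) g s y +
      ⟪u s y, FunctionSpaces.Torus.gradient (g s) y⟫_ℝ =
      κ * FunctionSpaces.Torus.laplacian (g s) y + f s y := by
    intro s hs y
    have hd : FunctionSpaces.Torus.timeDerivWithin (Icc a b) g s y = FunctionSpaces.Torus.timeDerivWithin S g s y :=
      ((hg.hasDerivWithinAt_slice (hI hs) y).mono hI).derivWithin (uniqueDiffOn_Icc hab s hs)
    rw [hd]
    exact heq s (hI hs) y
  exact le_add_of_source_Icc hab hg' heq' hκ hM hfF hΦ ht x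

omit [DecidableEq d] in
/-- **Maximum principle with a source term (two-sided).** Under the hypotheses of
`le_add_of_forall_init_le_of_source` with `|g(a, ·)| ≤ M` and `|f(t, ·)| ≤ F(t)`:
`|g(t, x)| ≤ M + (Φ(t) − Φ(a))` on `[a, b]` (apply the upper bound to `g` and to `−g`, which solves the equation with
source `−f`). [cite: Evans2010, §7.1.4 Thm. 8–9 (weak maximum principle with source)] -/
theorem abs_le_add_of_forall_abs_init_le_of_source (hg : FunctionSpaces.Torus.IsSmoothSpaceTimeOn S g)
    (heq : ∀ t ∈ S, ∀ x, FunctionSpaces.Torus.timeDerivWithin S g t x +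
        ⟪u t x, FunctionSpaces.Torus.gradient (g t) x⟫_ℝ =
        κ * FunctionSpaces.Torus.laplacian (g t) x + f t x)
    (hκ : 0 ≤ κ) {a b : ℝ} (hI : Icc a b ⊆ S) {M : ℝ} (hM : ∀ x, |g a x| ≤ M) {F Φ : ℝ → ℝ}
    (hfF : ∀ t ∈ Icc a b, ∀ x, |f t x| ≤ F t) (hΦ : ∀ t ∈ Icc a b, HasDerivWithinAt Φ (F t) (Icc a b) t)
    {t : ℝ} (ht : t ∈ Icc a b) (x : UnitAddTorus d) : |g t x| ≤ M + (Φ t - Φ a) := by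
  rcases eq_or_lt_of_le ht.1 with rfl | hat
  · simpa using hM x
  have hab : a < b := hat.trans_le ht.2
  have hU : UniqueDiffOn ℝ (Icc a b) := uniqueDiffOn_Icc hab
  have hg' := hg.mono hI
  have heq' : ∀ s ∈ Icc a b, ∀ y, FunctionSpaces.Torus.timeDerivWithin (Icc a b) g s y +
      ⟪u s y, FunctionSpaces.Torus.gradient (g s) y⟫_ℝ =
      κ * FunctionSpaces.Torus.laplacian (g s) y + f s y := by
    intro s hs y
    have hd : FunctionSpaces.Torus.timeDerivWithin (Icc a b) g s y = FunctionSpaces.Torus.timeDerivWithin S g s y :=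
      ((hg.hasDerivWithinAt_slice (hI hs) y).mono hI).derivWithin (hU s hs)
    rw [hd]
    exact heq s (hI hs) y
  rw [abs_le]
  refine ⟨?_, le_add_of_source_Icc hab hg' heq' hκ (fun y => (le_abs_self _).trans (hM y))
    (fun s hs y => (le_abs_self _).trans (hfF s hs y)) hΦ ht x⟩
  -- the equation for `-g`, with source `-f`
  have hneg : ∀ s ∈ Icc a b, ∀ y, FunctionSpaces.Torus.timeDerivWithin (Icc a b) (fun t x => -g t x) s y +
      ⟪u s y, FunctionSpaces.Torus.gradient (fun x => -g s x) y⟫_ℝ =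
      κ * FunctionSpaces.Torus.laplacian (fun x => -g s x) y + (-f s y) := by
    intro s hs y
    have hd : FunctionSpaces.Torus.timeDerivWithin (Icc a b) (fun t x => -g t x) s y =
        -FunctionSpaces.Torus.timeDerivWithin (Icc a b) g s y :=
      ((hg'.hasDerivWithinAt_slice hs y).neg).derivWithin (hU s hs)
    have hgr : FunctionSpaces.Torus.gradient (fun x => -g s x) y = -FunctionSpaces.Torus.gradient (g s) y := by
      change _root_.gradient (liftAt (fun x => -g s x) y) 0 = -_root_.gradient (liftAt (g s) y) 0
      rw [show liftAt (fun x => -g s x) y = fun v => -liftAt (g s) y v from rfl, _root_.gradient,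
        _root_.gradient, fderiv_fun_neg, map_neg]
    have hl : FunctionSpaces.Torus.laplacian (fun x => -g s x) y = -FunctionSpaces.Torus.laplacian (g s) y := by
      change (Δ (liftAt (fun x => -g s x) y)) 0 = -(Δ (liftAt (g s) y)) 0
      rw [show liftAt (fun x => -g s x) y = -liftAt (g s) y from rfl,
        InnerProductSpace.laplacian_neg, Pi.neg_apply]
    have he := heq' s hs y
    rw [hd, hgr, hl, inner_neg_right]
    linarith
  have hn := le_add_of_source_Icc hab hg'.neg hneg hκ (fun y => (neg_le_abs _).trans (hM y))
    (fun s hs y => (neg_le_abs _).trans ((abs_neg (f s y)).symm ▸ hfF s hs y)) hΦ ht x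
  linarith

omit [Fintype d] [DecidableEq d] in
/-- An antiderivative on `[a, b]` of a function continuous on `[a, b]`: `Φ(t) = ∫ₐᵗ F̃` with `F̃` the continuous
extension of `F` by its endpoint values (`F̃ = F` on `[a, b]`). [folklore] -/
private theorem exists_hasDerivWithinAt_integral {F : ℝ → ℝ} {a b : ℝ} (hab : a ≤ b)
    (hF : ContinuousOn F (Icc a b)) :
    ∃ Φ : ℝ → ℝ, (∀ t ∈ Icc a b, HasDerivWithinAt Φ (F t) (Icc a b) t) ∧
      ∀ t ∈ Icc a b, Φ t - Φ a = ∫ s in a..t, F s := by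
  set Ft : ℝ → ℝ := fun s => F (max a (min b s)) with hFt
  have hmem : ∀ s, max a (min b s) ∈ Icc a b := fun s =>
    ⟨le_max_left _ _, max_le hab (min_le_left _ _)⟩
  have hFtc : Continuous Ft :=
    hF.comp_continuous (continuous_const.max (continuous_const.min continuous_id)) hmem
  have hFt_eq : ∀ s ∈ Icc a b, Ft s = F s := fun s hs => by
    simp only [hFt, min_eq_right hs.2, max_eq_right hs.1]
  refine ⟨fun t => ∫ s in a..t, Ft s, fun t ht => ?_, fun t ht => ?_⟩
  · have h := (hFtc.integral_hasStrictDerivAt a t).hasDerivAt.hasDerivWithinAt (s := Icc a b)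
    rwa [hFt_eq t ht] at h
  · simp only [intervalIntegral.integral_same, sub_zero]
    refine intervalIntegral.integral_congr fun s hs => hFt_eq s ?_
    rw [uIcc_of_le ht.1] at hs
    exact ⟨hs.1, hs.2.trans ht.2⟩

omit [DecidableEq d] in
/-- **Maximum principle with a source term, integral form.** As `le_add_of_forall_init_le_of_source`, with `F`
continuous on `[a, b]`: `g(t, x) ≤ M + ∫ₐᵗ F`, i.e. `sup g(t, ·) ≤ sup g(a, ·) + ∫ₐᵗ sup_x f`.
[cite: Evans2010, §7.1.4 Thm. 8–9 (weak maximum principle with source)] -/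
theorem le_add_integral_of_source (hg : FunctionSpaces.Torus.IsSmoothSpaceTimeOn S g)
    (heq : ∀ t ∈ S, ∀ x, FunctionSpaces.Torus.timeDerivWithin S g t x +
        ⟪u t x, FunctionSpaces.Torus.gradient (g t) x⟫_ℝ =
        κ * FunctionSpaces.Torus.laplacian (g t) x + f t x)
    (hκ : 0 ≤ κ) {a b : ℝ} (hI : Icc a b ⊆ S) {M : ℝ} (hM : ∀ x, g a x ≤ M) {F : ℝ → ℝ}
    (hfF : ∀ t ∈ Icc a b, ∀ x, f t x ≤ F t) (hF : ContinuousOn F (Icc a b))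
    {t : ℝ} (ht : t ∈ Icc a b) (x : UnitAddTorus d) : g t x ≤ M + ∫ s in a..t, F s := by
  obtain ⟨Φ, hΦ, hΦint⟩ := exists_hasDerivWithinAt_integral (ht.1.trans ht.2) hF
  rw [← hΦint t ht]
  exact le_add_of_forall_init_le_of_source hg heq hκ hI hM hfF hΦ ht x

omit [DecidableEq d] in
/-- **Maximum principle with a source term, two-sided integral form**: `|g(t, x)| ≤ sup|g(a, ·)| + ∫ₐᵗ F` for
`|f(t, ·)| ≤ F(t)`, `F` continuous on `[a, b]`. [cite: Evans2010, §7.1.4 Thm. 8–9 (weak maximum principle with source)] -/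
theorem abs_le_add_integral_of_source (hg : FunctionSpaces.Torus.IsSmoothSpaceTimeOn S g)
    (heq : ∀ t ∈ S, ∀ x, FunctionSpaces.Torus.timeDerivWithin S g t x +
        ⟪u t x, FunctionSpaces.Torus.gradient (g t) x⟫_ℝ =
        κ * FunctionSpaces.Torus.laplacian (g t) x + f t x)
    (hκ : 0 ≤ κ) {a b : ℝ} (hI : Icc a b ⊆ S) {M : ℝ} (hM : ∀ x, |g a x| ≤ M) {F : ℝ → ℝ}
    (hfF : ∀ t ∈ Icc a b, ∀ x, |f t x| ≤ F t) (hF : ContinuousOn F (Icc a b))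
    {t : ℝ} (ht : t ∈ Icc a b) (x : UnitAddTorus d) : |g t x| ≤ M + ∫ s in a..t, F s := by
  obtain ⟨Φ, hΦ, hΦint⟩ := exists_hasDerivWithinAt_integral (ht.1.trans ht.2) hF
  rw [← hΦint t ht]
  exact abs_le_add_of_forall_abs_init_le_of_source hg heq hκ hI hM hfF hΦ ht x

end Source

end Torus

end Literature.Analysis.FluidPDE

end
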